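import Literature.MathematicalPhysics.QuantumFieldTheory.Balaban1983to89.B8Prop3SrcZd3HP2Gamma
import Literature.MathematicalPhysics.QuantumFieldTheory.Balaban1983to89.B8LeafModelZdHP2Per
import Literature.MathematicalPhysics.QuantumFieldTheory.Balaban1983to89.B8LeafModelZdPerProp3OfSockPer

/-!
# `Balaban1983to89.B8Prop3SrcZdHP2PerGamma` — [Balaban1985RegularSpaces] PROPOSITION 3 (p. 87) WITH SOURCE ((1.146) p. 101), AT THE PERIODIC MEMBER
# `zdGF3HP₂Per ∘ (ι, p)`, FROM A PERIODICITY-GUARDED SOURCED b9 SOCKET — brick T6e of the package «N05-(β′)-GT» (director-ym №227 (b) «GUARDED REQUIRED»;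
# plan g87 (R6)): dag-n05-d's D7-2b₂ `B8Prop3SrcZd3HP2Gamma.sp3src_zdGF3HP₂_map_of_sockB9P3srcHP₂_γ` RE-RUN TOKEN FOR TOKEN with the socket asked at PERIODIC data
# only and the conclusion = the `SP3src` binder of this seat's T6c `B8Thm8SurvivingZdGF3HP2PerMapLanEGammaGuarded` (p655863) VERBATIM

statement-level skeleton of published theorems with citation tags; proofs where landed; nothing here is a claim about the Yang–Mills mass gap

T. Bałaban, *Spaces of regular gauge field configurations on a lattice and gauge fixing conditions*, Commun. Math. Phys. **99** (1985) 75–102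
`[Balaban1985RegularSpaces]` ("B8"): Prop. 3 p. 87, (1.40)–(1.42) p. 83, (1.59)–(1.62) pp. 86–87, (1.36)–(1.39) p. 82 («on Ω_j»), Thm 8 (1.146) p. 101, p. 77 («Ω_j ⊂ T_η»).
T. Bałaban, *Propagators for lattice gauge theories in a background field*, Commun. Math. Phys. **99** (1985) 389–434 `[Balaban1985BackgroundPropagators]` ("[4]"):
Thm 3.3 p. 398 with (3.42)–(3.43), (3.40) p. 397.  PDF held: `paper:balaban1985-cmp99-regular-spaces-gauge-fixing`.

CITATION HEADER (lean-in-tree rule).  Cell `pub-ymgap` (HUMAN RULING D-0062, Track A), DAG node N05 = [B8], seat `pub-ymgap-dag-n05-c` (g17; package row (R6) T6e).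
WHY THIS FILE.  Theorem 8's surviving form on the GUARDED road (T6c) displays the sourced Proposition-3 hypothesis `SP3src` AT THE PERIODIC MEMBER (`U₀ : Cfg`,
`P′ : Pert`, `f : Src` of `zdGF3HP₂Per … (ι a) (p a)`).  dag-n05-d's ℤᵈ server derives the ℤᵈ `SP3src` from the sourced b9 socket `SB9srcH` ([4] Thm 3.3 with
source in Proposition 3's frame) asked at ALL unitary `U₀, W`, all sources `f`, all exponents `A′` on `ℤᵈ` — the BANKED species (director-ym №227 (b)).  THIS FILE
asks the socket at PERIODIC arguments only (`SB9srcH2Per` := `SB9srcH`'s text + `IsPeriodic (p a)` on `U₀`, `W`, `f`, `A′`) and concludes at the periodic member;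
the proof is the ℤᵈ one token for token, the four guards discharged BY NAME: `U₀.2.2`, `P′.2.2.2` (carriers), `f.2` (periodic source), and the canonical masked
exponent `A := mlogCfg k η {Ω_j} W` periodic by dag-n05-w1's `B8LeafModelZdPerProp3OfSockPer.isPeriodic_mlogCfg_of_isPeriodic` over the `(p a)`-periodic `Ω_j`
(member law `hΩp`).  Engines (`prop3_norms_kLevel_src4_γ`, `prop3_fifth_kLevel_src_γ`, windows, (1.36)₁ pointwise) unchanged.

WHAT THIS FILE PROVES (one theorem, no `def`).
★★ `sp3src_zdGF3HP₂Per_map_of_sockB9P3srcH2Per_γ` — for any `ι : J → ZdIdx d L`, `p : J → ℕ` with `(p a)`-periodic `Ω_j` (`j ≤ k`): from the GUARDED sourced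
Prop.-3-frame socket at each `ι a`, `∃ c > 0` such that print's Prop.-3 sentence WITH SOURCE holds at `zdGF3HP₂Per 𝔸 L β len (ι a) (p a)`: (1.40)–(1.42) + (1.146) +
(1.61) ⇒ (1.36) ∧ (1.39) at `B₁ = 5dL·B₈`, `B₂ = 5dL·B₈β` — T6c's `SP3src` binder text.

HONEST SCOPE.  Assembly BY NAME; the guarded sourced socket is a HYPOTHESIS (N06 content; [4] Thm 3.3 with source on the torus — askable at periodic data, NOT yet
served); `≤` where print has `<`; `T_η` as `(p a)`-periodic data on `ηℤᵈ`.  Count-neutral; N05 NOT discharged; one finite `T⁴` programme at fixed `ε`, Bałaban as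
printed — nothing continuum ∕ ℝ⁴ ∕ OS ∕ mass-gap ∕ Clay.  No `sorry`, no `def`, no `instance`, no `notation`.  Unit `pub-ymgap-dag-n05-c` (g17), 2026-08-28.
-/

noncomputable section

open NormedSpace

namespace Literature.MathematicalPhysics.QuantumFieldTheory.Balaban1983to89.B8Prop3SrcZdHP2PerGamma

open Complex (I)
open MatrixLog B7Prop1Explicit B7Prop2Explicit B7Prop1Local B7Eq92Concrete
open B7Prop2Explicit (C0 c2' unitaryUnits unitaryUnits_le_U1 avgClosed_unitaryUnits)
open B7Prop3Flat (c3)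
open B7Prop4GeneralLevels (logCovIter linCovIter)
open B8Lemma1NonAbelian (mulCfg)
open B8Ineq132 (covDerivFwd InAk BondTouches)
open B8Eq146AExpansion (iEta expCfg plaqCovDeriv)
open B8Eq143PlaqExpansion (pdiv)
open B8Eq155JBound (Jcur wsup)
open B8Eq140Level (SideTouches)
open B8Eq184Proof (cfgExp)
open B8ScaledSupNorm (bondNorm msup weight Bdd)
open B8Eq155KLevelLocal (eq155_norm_kLevel_hermitian)
open B8Prop3KLevelGamma (wsup_B1_le_kLevel_γ prop3_windows_γ)
open B8Prop3KLevel (bound_of_sideTouches)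
open B8Eq138LandauZd (IsLandau146W InR138 logCfg covLap)
open B8Prop3GaugeFixedKLevel (inAk_congr_of_sideTouches expCfg_iEta_eq_cfgExp cfgExp_congr_at)
open B8LeafModelZd (ZdIdx)
open B8LeafModelZd3 (zdGF3 mlogCfg mlogCfg_of_sideTouches mlogCfg_of_not)
open B8LeafModelZd3H (zdGF3H)
open B8LeafModelZd3P (zdGF3P zdGF3HP)
open B8LeafModelZd3P2 (zdGF3P₂ zdGF3HP₂)
open B8TowerBondsPrinted (towerBondsP towerBondsP_box_subset_pred)
open B8Prop3SrcZd3 (apriori_160_src4 apriori_160_fifth_src)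
open B8Prop3SrcZd3Gamma (prop3_norms_kLevel_src4_γ prop3_fifth_kLevel_src_γ)
open B9Eq340HolderZd (hquot AdmPair)

-- `Site` alone could resolve to the torus sites of `Setup.lean`; re-export the `ℤ^d` sites of `B7Prop1Explicit`.
export B7Prop1Explicit (Site)
open B8LeafModelZdHP2Per (zdGF3HP₂Per)
open B8LeafModelZdPerProp3OfSockPer (isPeriodic_mlogCfg_of_isPeriodic)
open T4TermwiseTorus (IsPeriodic)

variable {d : ℕ}

section ZdHP2Per

variable {𝔸 : Type} [CStarAlgebra 𝔸] [Nontrivial 𝔸]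

/-- ★★ **PROPOSITION 3 WITH SOURCE AT THE PERIODIC MEMBER `zdGF3HP₂Per … (ι a) (p a)`, FROM THE PERIODICITY-GUARDED SOURCED b9 SOCKET** — dag-n05-d's
`sp3src_zdGF3HP₂_map_of_sockB9P3srcHP₂_γ` token for token with: index + period maps `(ι, p)`, member law `hΩp` (`Ω_j` periodic, `j ≤ k`), the socket
`SB9srcH2Per` = `SB9srcH` asked at PERIODIC `U₀, W`, periodic source `f`, periodic exponent `A′` only ([4] Thm 3.3 with source, (3.42)–(3.43): the five (1.59)
lines with source terms, Hölder line on Ω_j × Ω_j pairs, `|B₁|` over print's class `towerBondsP`), and the conclusion at the periodic member (`U₀ : Cfg`, `P′ : Pert`,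
`f : Src` periodic): `∃ c > 0`, ∀ a, ∀ `α₀, α₁, α₂ ≤ c` with (1.61), (1.40)–(1.42) ∧ (1.146) ∧ `‖f‖, ‖∇f‖ < γ(α₀+α₁)` ⇒ (1.36) at `(5dL·B₈, 5dL·B₈β)` ∧ (1.39) at
`5dL·B₈` — EXACTLY T6c's `SP3src` binder.  Guards discharged by `U₀.2.2`, `P′.2.2.2`, `f.2` and `isPeriodic_mlogCfg_of_isPeriodic`.
[cite: Balaban1985RegularSpaces, Prop. 3 p.87, (1.40)–(1.42) p.83, (1.61)–(1.62) p.87, (1.36)–(1.39) p.82, Thm 8 (1.146) p.101, p.77 («Ω_j ⊂ T_η»); Balaban1985BackgroundPropagators, Thm 3.3 p.398, (3.40) p.397] -/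
theorem sp3src_zdGF3HP₂Per_map_of_sockB9P3srcH2Per_γ (hd2 : 2 ≤ d) {L : ℕ} (hL : 2 ≤ L) {B₀ B₀β cP γ γ'' γβ B₈ B₈β : ℝ} (hB₀ : 0 < B₀) (hB₀β : 0 ≤ B₀β)
    (hcP : 0 < cP) (hγ'' : 0 ≤ γ'') (hB8 : 5 * (d : ℝ) * L * B₀ + 2 * (γ'' * B₀) ≤ 5 * (d : ℝ) * L * B₈)
    (hB8β : 5 * (d : ℝ) * L * B₀β + 2 * B₀β * (γ'' * B₀) + γβ ≤ 5 * (d : ℝ) * L * B₈β) (β : ℝ) (len : Site d → ℝ)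
    {J : Type} (ι : J → ZdIdx d L) (p : J → ℕ)
    -- the domains `Ω_j`, `j ≤ k`, of every member are `(p a)`-periodic (the periodic (1.5)-index's law; print's «Ω_j ⊂ T_η», p. 77)
    (hΩp : ∀ a : J, ∀ j, j ≤ (ι a).k → IsPeriodic (p a) (fun x : Site d => x ∈ (ι a).Ω j))
    -- THE GUARDED SOURCED b9 SOCKET OF PROPOSITION 3's FRAME: dag-n05-d's `SB9srcH` text asked at PERIODIC `U₀, W`, a PERIODIC source `f` and a PERIODIC exponent `A′` only
    (SB9srcH2Per : ∀ a : J, ∀ α₀ α₁ α₂ : ℝ, 0 < α₀ → α₀ ≤ cP → 0 < α₁ → 0 < α₂ → α₂ ≤ cP →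
      ∀ (U₀ W : Site d → Fin d → 𝔸ˣ), (∀ x κ, U₀ x κ ∈ unitaryUnits 𝔸) → (∀ x κ, W x κ ∈ unitaryUnits 𝔸) →
      IsPeriodic (p a) U₀ → IsPeriodic (p a) W →
      ∀ f : Site d → 𝔸, IsPeriodic (p a) f → InR138 L (ι a).k (ι a).η ((ι a).Ω 0) ((ι a).Λs (ι a).k) U₀ f →
      (∀ x, IsSelfAdjoint (f x)) → (∀ x, x ∉ (ι a).Ω 0 → f x = 0) →
      Bdd L (ι a).k (ι a).η (-(2 : ℝ)) (fun j (x : Site d) => x ∈ (ι a).Ω j) f →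
      msup L (ι a).k (ι a).η (-(2 : ℝ)) (fun j (x : Site d) => x ∈ (ι a).Ω j) f < γ * (α₀ + α₁) →
      msup L (ι a).k (ι a).η (-(3 : ℝ)) (fun j (p : Fin d × Site d) => p.2 ∈ (ι a).Ω j) (fun p => covDerivFwd (ι a).η U₀ p.1 f p.2) < γ * (α₀ + α₁) →
      InAk L (ι a).k (ι a).η α₀ (ι a).Ω U₀ → InAk L (ι a).k (ι a).η α₀ (ι a).Ω (mulCfg W U₀) → IsLandau146W L (ι a).k (ι a).η ((ι a).Ω 0) ((ι a).Λs (ι a).k) U₀ f W →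
      ∀ A' : Site d → Fin d → 𝔸, (∀ y τ, IsSelfAdjoint (A' y τ)) → IsPeriodic (p a) A' →
      (∀ j, j ≤ (ι a).k → ∀ (y : Site d) (τ : Fin d), SideTouches ((ι a).Ω j) y τ →
        W y τ = cfgExp (ι a).η A' y τ ∧ ‖A' y τ‖ ≤ α₂ * ((L : ℝ) ^ j * (ι a).η)⁻¹) →
      (∀ (y : Site d) (τ : Fin d), (∀ j, j ≤ (ι a).k → ¬ SideTouches ((ι a).Ω j) y τ) → A' y τ = 0) →
      msup L (ι a).k (ι a).η (-(1 : ℝ)) (fun j (b : Site d × Fin d) => SideTouches ((ι a).Ω j) b.1 b.2) (fun b => A' b.1 b.2)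
          ≤ B₀ * (bondNorm L (ι a).k (ι a).η (-(3 : ℝ)) (ι a).Ω (fun x μ => Jcur (ι a).η U₀ A' μ x)
            + wsup 1 (fun p : {p : ℕ × (Site d × Fin d) // p.1 ≤ (ι a).k ∧ p.2 ∈ towerBondsP L (ι a).Ω ((ι a).Λs (ι a).k) p.1} =>
                linCovIter L U₀ (iEta (ι a).η A') p.1.1 p.1.2.1 p.1.2.2)) + γ'' * B₀ * (α₀ + α₁) ∧
        msup L (ι a).k (ι a).η (-(2 : ℝ)) (fun j (t : Fin d × Fin d × Site d) => SideTouches ((ι a).Ω j) t.2.2 t.2.1)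
            (fun t => covDerivFwd (ι a).η U₀ t.1 (fun z => A' z t.2.1) t.2.2)
          ≤ B₀ * (bondNorm L (ι a).k (ι a).η (-(3 : ℝ)) (ι a).Ω (fun x μ => Jcur (ι a).η U₀ A' μ x)
            + wsup 1 (fun p : {p : ℕ × (Site d × Fin d) // p.1 ≤ (ι a).k ∧ p.2 ∈ towerBondsP L (ι a).Ω ((ι a).Λs (ι a).k) p.1} =>
                linCovIter L U₀ (iEta (ι a).η A') p.1.1 p.1.2.1 p.1.2.2)) + γ'' * B₀ * (α₀ + α₁) ∧
        bondNorm L (ι a).k (ι a).η (-(3 : ℝ)) (ι a).Ω (fun x μ => pdiv (ι a).η U₀ (plaqCovDeriv (ι a).η U₀ A') μ x)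
          ≤ B₀ * (bondNorm L (ι a).k (ι a).η (-(3 : ℝ)) (ι a).Ω (fun x μ => Jcur (ι a).η U₀ A' μ x)
            + wsup 1 (fun p : {p : ℕ × (Site d × Fin d) // p.1 ≤ (ι a).k ∧ p.2 ∈ towerBondsP L (ι a).Ω ((ι a).Λs (ι a).k) p.1} =>
                linCovIter L U₀ (iEta (ι a).η A') p.1.1 p.1.2.1 p.1.2.2)) + γ'' * B₀ * (α₀ + α₁) ∧
        bondNorm L (ι a).k (ι a).η (-(3 : ℝ)) (ι a).Ω (fun x μ => covLap (ι a).η U₀ (fun z => A' z μ) x)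
          ≤ B₀ * (bondNorm L (ι a).k (ι a).η (-(3 : ℝ)) (ι a).Ω (fun x μ => Jcur (ι a).η U₀ A' μ x)
            + wsup 1 (fun p : {p : ℕ × (Site d × Fin d) // p.1 ≤ (ι a).k ∧ p.2 ∈ towerBondsP L (ι a).Ω ((ι a).Λs (ι a).k) p.1} =>
                linCovIter L U₀ (iEta (ι a).η A') p.1.1 p.1.2.1 p.1.2.2)) + γ'' * B₀ * (α₀ + α₁) ∧
        msup L (ι a).k (ι a).η (-(2 + β)) (fun j (q : Fin d × Fin d × (Site d × Site d)) => q.2.2 ∈ AdmPair (ι a).η len ∧ q.2.2.1 ∈ (ι a).Ω j ∧ q.2.2.2 ∈ (ι a).Ω j)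
            (fun q => hquot (ι a).η β len U₀ (covDerivFwd (ι a).η U₀ q.1 (fun z => A' z q.2.1)) q.2.2)
          ≤ B₀β * (bondNorm L (ι a).k (ι a).η (-(3 : ℝ)) (ι a).Ω (fun x μ => Jcur (ι a).η U₀ A' μ x)
            + wsup 1 (fun p : {p : ℕ × (Site d × Fin d) // p.1 ≤ (ι a).k ∧ p.2 ∈ towerBondsP L (ι a).Ω ((ι a).Λs (ι a).k) p.1} =>
                linCovIter L U₀ (iEta (ι a).η A') p.1.1 p.1.2.1 p.1.2.2)) + γβ * (α₀ + α₁)) :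
    ∃ c : ℝ, 0 < c ∧ ∀ a : J, ∀ α₀ α₁ α₂ : ℝ, 0 < α₀ → α₀ ≤ c → 0 < α₁ → α₁ ≤ c → 0 < α₂ → α₂ ≤ c →
      2 * α₂ ^ 2 + 20 * d * α₀ * α₂ + 2 * (2097152 * ((d : ℝ) + 1) ^ 2 * (L : ℝ) ^ 2) * α₂ ^ 2 ≤ α₀ + α₁ →
      ∀ (U₀ : (zdGF3HP₂Per 𝔸 L β len (ι a) (p a)).Cfg) (P' : (zdGF3HP₂Per 𝔸 L β len (ι a) (p a)).Pert) (f : (zdGF3HP₂Per 𝔸 L β len (ι a) (p a)).Src),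
        (zdGF3HP₂Per 𝔸 L β len (ι a) (p a)).InR U₀ f → (zdGF3HP₂Per 𝔸 L β len (ι a) (p a)).fNorm f < γ * (α₀ + α₁) → (zdGF3HP₂Per 𝔸 L β len (ι a) (p a)).fGrad U₀ f < γ * (α₀ + α₁) →
        (zdGF3HP₂Per 𝔸 L β len (ι a) (p a)).InA α₀ U₀ → (zdGF3HP₂Per 𝔸 L β len (ι a) (p a)).InAPair α₀ U₀ P' → (zdGF3HP₂Per 𝔸 L β len (ι a) (p a)).C162 1 α₂ U₀ P' →
        (zdGF3HP₂Per 𝔸 L β len (ι a) (p a)).LandauF U₀ f P' → (zdGF3HP₂Per 𝔸 L β len (ι a) (p a)).C137 α₁ U₀ P' →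
        (zdGF3HP₂Per 𝔸 L β len (ι a) (p a)).C136 (5 * d * L * B₈) (5 * d * L * B₈β) (α₀ + α₁) U₀ P' ∧
          (zdGF3HP₂Per 𝔸 L β len (ι a) (p a)).C139 (5 * d * L * B₈) (α₀ + α₁) U₀ P' := by
  have hL1 : 1 ≤ L := le_trans (by norm_num) hL
  have hLr : (1 : ℝ) ≤ L := by exact_mod_cast hL1
  have hB₀' : 0 ≤ B₀ := hB₀.le
  have hL0 : (0 : ℝ) < L := by linarith
  obtain ⟨cN, hcN, hwin⟩ := prop3_windows_γ hd2 hL hB₀'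
  refine ⟨min cP (cN / (L : ℝ) ^ 2), lt_min hcP (by positivity), ?_⟩
  intro a α₀ α₁ α₂ hα₀ hα₀c hα₁ _ hα₂ hα₂c h61 U₀ P f hInR hfN hfG hInA hPair h162 hLan h137
  have hα₀P : α₀ ≤ cP := hα₀c.trans (min_le_left _ _)
  have hα₂P : α₂ ≤ cP := hα₂c.trans (min_le_left _ _)
  have hL2 : (0 : ℝ) < (L : ℝ) ^ 2 := by positivity
  have hα₀N : (L : ℝ) ^ 2 * α₀ ≤ cN := by
    have := hα₀c.trans (min_le_right _ _)
    rw [le_div_iff₀ hL2] at this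
    linarith
  have hα₂N : (L : ℝ) * α₂ ≤ cN := by
    have h1 := hα₂c.trans (min_le_right _ _)
    rw [le_div_iff₀ hL2] at h1
    have h2 : (L : ℝ) * α₂ ≤ α₂ * (L : ℝ) ^ 2 := by
      have h3 : (L : ℝ) * α₂ * 1 ≤ (L : ℝ) * α₂ * L := mul_le_mul_of_nonneg_left hLr (by positivity)
      nlinarith [h3]
    linarith
  obtain ⟨hα3, hα4, h16, hd5, hsmall, hc₃, hside, h50, hC⟩ := hwin α₀ α₂ hα₀ hα₀N hα₂.le hα₂N
  have hC₂' : 8 * (131072 * ((d : ℝ) + 1) ^ 2) * Real.exp (4 * (800 * ((d : ℝ) + 1) ^ 2 * ((d : ℝ) + 4)) * ((L : ℝ) ^ 2 * α₀))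
      * (L : ℝ) ^ 2 ≤ 2097152 * ((d : ℝ) + 1) ^ 2 * (L : ℝ) ^ 2 := hC
  have hS0 : 0 ≤ α₀ + α₁ := by linarith
  have hT0 : 0 ≤ γ'' * B₀ * (α₀ + α₁) := by positivity
  -- the data
  set W : Site d → Fin d → 𝔸ˣ := P.2.1 with hW_def
  have hWu : ∀ x κ, W x κ ∈ unitaryUnits 𝔸 := P.2.2.1
  have hU₀ : ∀ x κ, U₀.1 x κ ∈ unitaryUnits 𝔸 := U₀.2.1
  -- the periodicity of the data (carriers) and of the canonical masked exponent (dag-n05-w1's mask lemma over the periodic `Ω_j`)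
  have hU₀p : IsPeriodic (p a) U₀.1 := U₀.2.2
  have hWp : IsPeriodic (p a) W := P.2.2.2
  set A : Site d → Fin d → 𝔸 := mlogCfg (ι a).k (ι a).η (ι a).Ω W with hA_def
  have hAp : IsPeriodic (p a) A := isPeriodic_mlogCfg_of_isPeriodic (ι a).k (ι a).η (hΩp a) hWp
  -- (1.41) and self-adjointness of the canonical exponent; `W = e^{iηA}` on the `E j`
  have h41 : ∀ j, j ≤ (ι a).k → ∀ (y : Site d) (τ : Fin d), SideTouches ((ι a).Ω j) y τ →
      W y τ = cfgExp (ι a).η A y τ ∧ ‖A y τ‖ ≤ α₂ * ((L : ℝ) ^ j * (ι a).η)⁻¹ := by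
    intro j hj y τ hs
    obtain ⟨hexp, -, hbd⟩ := h162 j hj (y, τ) hs
    have hexp' : W y τ = cfgExp (ι a).η (logCfg (ι a).η W) y τ := hexp
    have hbd' : ‖logCfg (ι a).η W y τ‖ ≤ 1 * α₂ * ((L : ℝ) ^ j * (ι a).η)⁻¹ := hbd
    have hAy : A y τ = logCfg (ι a).η W y τ := mlogCfg_of_sideTouches (ι a).η W hj hs
    refine ⟨?_, ?_⟩
    · rw [hexp']
      exact cfgExp_congr_at (ι a).η hAy.symm
    · rw [hAy]
      simpa only [one_mul] using hbd'
  have hAsa : ∀ y τ, IsSelfAdjoint (A y τ) := by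
    intro y τ
    by_cases hmem : ∃ j, j ≤ (ι a).k ∧ SideTouches ((ι a).Ω j) y τ
    · obtain ⟨j, hj, hs⟩ := hmem
      rw [hA_def, mlogCfg_of_sideTouches (ι a).η W hj hs]
      exact (h162 j hj (y, τ) hs).2.1
    · rw [hA_def, mlogCfg_of_not (ι a).η W fun j hj hs => hmem ⟨j, hj, hs⟩]
      exact IsSelfAdjoint.zero 𝔸
  have hA0 : ∀ (y : Site d) (τ : Fin d), (∀ j, j ≤ (ι a).k → ¬ SideTouches ((ι a).Ω j) y τ) → A y τ = 0 :=
    fun y τ h => mlogCfg_of_not (ι a).η W h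
  -- (1.40)₁ for `e^{iηA}U₀` by locality; the Landau clause for `e^{iηA}` by locality
  have h40₁ : InAk L (ι a).k (ι a).η α₀ (ι a).Ω (mulCfg (expCfg (iEta (ι a).η A)) U₀.1) := by
    refine (inAk_congr_of_sideTouches L (ι a).k (ι a).η α₀ (V := mulCfg W U₀.1) fun j hj y τ hs => ?_).1 hPair
    show W y τ * U₀.1 y τ = expCfg (iEta (ι a).η A) y τ * U₀.1 y τ
    rw [(h41 j hj y τ hs).1, expCfg_iEta_eq_cfgExp]
  -- the global bound and the gradient datum (bounded family)
  have hAglob : ∀ y τ, ‖A y τ‖ ≤ α₂ * (ι a).η⁻¹ := by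
    intro y τ
    by_cases hmem : ∃ j, j ≤ (ι a).k ∧ SideTouches ((ι a).Ω j) y τ
    · obtain ⟨j, hj, hs⟩ := hmem
      have hLj : (1 : ℝ) ≤ (L : ℝ) ^ j := one_le_pow₀ hLr
      have hη0 : 0 < (ι a).η := (ι a).hη
      calc ‖A y τ‖ ≤ α₂ * ((L : ℝ) ^ j * (ι a).η)⁻¹ := (h41 j hj y τ hs).2
        _ = α₂ * (ι a).η⁻¹ * ((L : ℝ) ^ j)⁻¹ := by rw [mul_inv]; ring
        _ ≤ α₂ * (ι a).η⁻¹ * 1 := by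
            apply mul_le_mul_of_nonneg_left (inv_le_one_of_one_le₀ hLj) (by positivity)
        _ = α₂ * (ι a).η⁻¹ := mul_one _
    · rw [hA0 y τ fun j hj hs => hmem ⟨j, hj, hs⟩, norm_zero]
      have hη0 : 0 < (ι a).η := (ι a).hη
      positivity
  have hU₀1 : ∀ x κ, U₀.1 x κ ∈ U1 𝔸 := fun x κ => unitaryUnits_le_U1 (hU₀ x κ)
  have hgrad : ∀ (y : Site d) (κ τ : Fin d), ‖covDerivFwd (ι a).η U₀.1 κ (fun z => A z τ) y‖ ≤ 2 * α₂ * (ι a).η⁻¹ * (ι a).η⁻¹ := by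
    intro y κ τ
    have hη0 : 0 < (ι a).η := (ι a).hη
    unfold covDerivFwd
    rw [norm_smul, norm_inv, Real.norm_eq_abs, abs_of_pos hη0]
    have h1 : ‖B7Eq78Linearization.conjR (U₀.1 y κ) (A (y + e κ) τ) - A y τ‖ ≤ α₂ * (ι a).η⁻¹ + α₂ * (ι a).η⁻¹ := by
      calc ‖B7Eq78Linearization.conjR (U₀.1 y κ) (A (y + e κ) τ) - A y τ‖
          ≤ ‖B7Eq78Linearization.conjR (U₀.1 y κ) (A (y + e κ) τ)‖ + ‖A y τ‖ := norm_sub_le _ _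
        _ ≤ α₂ * (ι a).η⁻¹ + α₂ * (ι a).η⁻¹ := by
            rw [B8Ineq132.norm_conjR (hU₀1 y κ)]
            exact add_le_add (hAglob _ _) (hAglob _ _)
    calc (ι a).η⁻¹ * ‖B7Eq78Linearization.conjR (U₀.1 y κ) (A (y + e κ) τ) - A y τ‖ ≤ (ι a).η⁻¹ * (α₂ * (ι a).η⁻¹ + α₂ * (ι a).η⁻¹) :=
        mul_le_mul_of_nonneg_left h1 (by positivity)
      _ = 2 * α₂ * (ι a).η⁻¹ * (ι a).η⁻¹ := by ring
  have hBg : Bdd L (ι a).k (ι a).η (-(2 : ℝ)) (fun j (t : Fin d × Fin d × Site d) => SideTouches ((ι a).Ω j) t.2.2 t.2.1)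
      (fun t => covDerivFwd (ι a).η U₀.1 t.1 (fun z => A z t.2.1) t.2.2) := by
    have e2 : (-(2 : ℝ)) = -((2 : ℕ) : ℝ) := by norm_num
    rw [e2]
    refine B8ScaledSupNorm.bdd_of_forall (c := 2 * α₂ * ((L : ℝ) ^ (ι a).k) ^ 2) fun j hj t _ => ?_
    rw [B8ScaledSupNorm.weight_neg_natCast L (ι a).η 2 j]
    have hLjk : (L : ℝ) ^ j ≤ (L : ℝ) ^ (ι a).k := pow_le_pow_right₀ hLr hj
    have hLj0 : (0 : ℝ) ≤ (L : ℝ) ^ j := by positivity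
    have hη0 : 0 < (ι a).η := (ι a).hη
    calc ((L : ℝ) ^ j * (ι a).η) ^ 2 * ‖covDerivFwd (ι a).η U₀.1 t.1 (fun z => A z t.2.1) t.2.2‖
        ≤ ((L : ℝ) ^ j * (ι a).η) ^ 2 * (2 * α₂ * (ι a).η⁻¹ * (ι a).η⁻¹) := mul_le_mul_of_nonneg_left (hgrad _ _ _) (by positivity)
      _ = 2 * α₂ * ((L : ℝ) ^ j) ^ 2 := by field_simp
      _ ≤ 2 * α₂ * ((L : ℝ) ^ (ι a).k) ^ 2 := by gcongr
  set g : ℝ := msup L (ι a).k (ι a).η (-(2 : ℝ)) (fun j (t : Fin d × Fin d × Site d) => SideTouches ((ι a).Ω j) t.2.2 t.2.1)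
      (fun t => covDerivFwd (ι a).η U₀.1 t.1 (fun z => A z t.2.1) t.2.2) with hg_def
  have hg0 : 0 ≤ g := B8ScaledSupNorm.msup_nonneg L (ι a).k (ι a).hη.le _ _ _
  have hg : ∀ j, j ≤ (ι a).k → ∀ (y : Site d) (κ τ : Fin d), SideTouches ((ι a).Ω j) y τ →
      ((L : ℝ) ^ j * (ι a).η) ^ 2 * ‖covDerivFwd (ι a).η U₀.1 κ (fun z => A z τ) y‖ ≤ g := by
    intro j hj y κ τ hs
    have h := B8ScaledSupNorm.weight_mul_norm_le_msup hBg hj (i := (κ, τ, y)) hs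
    have hw : weight L (ι a).η (-(2 : ℝ)) j = ((L : ℝ) ^ j * (ι a).η) ^ 2 := by
      have e2 : (-(2 : ℝ)) = -((2 : ℕ) : ℝ) := by norm_num
      rw [e2, B8ScaledSupNorm.weight_neg_natCast L (ι a).η 2 j]
    rw [hw] at h
    exact h
  -- the Landau clause for `e^{iηA}` and the in-edge (1.59), five lines, from the socket
  have hLanA : IsLandau146W L (ι a).k (ι a).η ((ι a).Ω 0) ((ι a).Λs (ι a).k) U₀.1 f.1 W := hLan
  obtain ⟨h59a, h59g, h59j, h59l, h59h⟩ := SB9srcH2Per a α₀ α₁ α₂ hα₀ hα₀P hα₁ hα₂ hα₂P U₀.1 W hU₀ hWu hU₀p hWp f.1 f.2 hInR.1 hInR.2.1 hInR.2.2.1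
    hInR.2.2.2 hfN hfG hInA hPair hLanA A hAsa hAp h41 hA0
  -- (1.42) = the member's (1.37) clause, on the classified constraint bonds of the top truncation
  have hbox : ∀ j, j ≤ (ι a).k → ∀ c ∈ towerBondsP L (ι a).Ω ((ι a).Λs (ι a).k) j,
      ∀ x, InBox (loK L j c.1) (bondHiK L j c.1 c.2) x → x ∈ (ι a).Ω (j - 1) :=
    fun j _ c hc x hx => towerBondsP_box_subset_pred L (ι a).hΩ ((ι a).Λs (ι a).k) hc x hx
  have h42 : ∀ j, j ≤ (ι a).k → ∀ c ∈ towerBondsP L (ι a).Ω ((ι a).Λs (ι a).k) j,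
      ‖logCovIter L U₀.1 (iEta (ι a).η A) j c.1 c.2‖ < 2 * d * L * α₁ := h137
  have h41' : ∀ j, j ≤ (ι a).k → ∀ (y : Site d) (τ : Fin d), SideTouches ((ι a).Ω j) y τ → ‖A y τ‖ ≤ α₂ * ((L : ℝ) ^ j * (ι a).η)⁻¹ :=
    fun j hj y τ hs => (h41 j hj y τ hs).2
  -- PROPOSITION 3 at `k` levels (n05-b), all four members, and the Hölder member
  obtain ⟨ha, hg', hj, hl⟩ := prop3_norms_kLevel_src4_γ hd2 (ι a).hη hL hU₀ hAsa hα₀ hα₁.le hα₂.le hg0 hα3 hα4 h16 hd5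
    hsmall hc₃ hB₀' hside h50 hC₂' h61 hbox hInA h40₁ h41' hg h42 h59a h59g h59j h59l
  have hh := prop3_fifth_kLevel_src_γ hd2 (ι a).hη hL hU₀ hAsa hα₀ hα₁.le hα₂.le hg0 hα3 hα4 h16 hd5 hsmall hc₃ hB₀' hB₀β
    hside h50 hC₂' h61 hbox hInA h40₁ h41' hg h42 hT0 h59g h59h
  -- the enlarged constants absorb the source terms
  have hc8 : 5 * (d : ℝ) * L * B₀ * (α₀ + α₁) + (γ'' * B₀ * (α₀ + α₁) + γ'' * B₀ * (α₀ + α₁)) ≤ 5 * (d : ℝ) * L * B₈ * (α₀ + α₁) := by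
    have h := mul_le_mul_of_nonneg_right hB8 hS0
    calc 5 * (d : ℝ) * L * B₀ * (α₀ + α₁) + (γ'' * B₀ * (α₀ + α₁) + γ'' * B₀ * (α₀ + α₁))
        = (5 * (d : ℝ) * L * B₀ + 2 * (γ'' * B₀)) * (α₀ + α₁) := by ring
      _ ≤ 5 * (d : ℝ) * L * B₈ * (α₀ + α₁) := h
  have hc8β : 5 * (d : ℝ) * L * B₀β * (α₀ + α₁) + (2 * B₀β * (γ'' * B₀ * (α₀ + α₁)) + γβ * (α₀ + α₁)) ≤
      5 * (d : ℝ) * L * B₈β * (α₀ + α₁) := by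
    have h := mul_le_mul_of_nonneg_right hB8β hS0
    calc 5 * (d : ℝ) * L * B₀β * (α₀ + α₁) + (2 * B₀β * (γ'' * B₀ * (α₀ + α₁)) + γβ * (α₀ + α₁))
        = (5 * (d : ℝ) * L * B₀β + 2 * B₀β * (γ'' * B₀) + γβ) * (α₀ + α₁) := by ring
      _ ≤ 5 * (d : ℝ) * L * B₈β * (α₀ + α₁) := h
  have ha' : msup L (ι a).k (ι a).η (-(1 : ℝ)) (fun j (b : Site d × Fin d) => SideTouches ((ι a).Ω j) b.1 b.2) (fun b => A b.1 b.2) ≤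
      5 * (d : ℝ) * L * B₈ * (α₀ + α₁) := ha.trans hc8
  refine ⟨⟨fun j hj b hb => ?_, hg'.trans (by linarith [hc8]), hh.trans hc8β⟩, hj.trans hc8, hl.trans hc8⟩
  -- (1.36)₁ pointwise on the `E j`, read on the logarithm
  obtain ⟨hexp, hsa, -⟩ := h162 j hj b hb
  refine ⟨hexp, hsa, ?_⟩
  have hpt := B8Thm2GaugeFixedKLevel.thm2_pointwise_A (ι a).hη hL1 h41' ha' hj (y := b.1) (τ := b.2) hb
  rw [← mlogCfg_of_sideTouches (ι a).η W hj hb]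
  exact hpt

end ZdHP2Per

#print axioms sp3src_zdGF3HP₂Per_map_of_sockB9P3srcH2Per_γ

end Literature.MathematicalPhysics.QuantumFieldTheory.Balaban1983to89.B8Prop3SrcZdHP2PerGamma

end
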